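import Summits.ResolutionOfSingularities.KangarooAtlas.MizutaniFrobTensor
import Mathlib.FieldTheory.IntermediateField.Adjoin.Basic
import Mathlib.FieldTheory.Minpoly.Field
import Mathlib.Algebra.Polynomial.Degree.Domain
import Mathlib.Algebra.Polynomial.BigOperators
import Mathlib.Data.Fin.Tuple.Basic
import HarnessLib

/-!
# Mizutani's conjecture `m(e) = 2p^e − 1` — finite `p`-independent families (p-bases, the finite part)

Cell topic `Summits/ResolutionOfSingularities/KangarooAtlas` (pub-rosobs); part of the Lean transcription of
the in-house note MIZUTANI-PROOF-g59 (AI-written; *AI review is weaker than expert review*; not a resolution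
theorem).  §3 DICTIONARY, step (F): the note's `p`-BASIS of the ground field (§3 (c), §9) replaced by its finite
core, without Zorn: `PIndep p j b` (box monomials `b^W`, `W_i < p^j`, independent over `k^{p^j}`), level lifting
`PIndep.succ`/`PIndep.of_one`, the EXCHANGE lemma `PIndep.cons` (`y ∉ k^p(b)` ⇒ `(y, b)` `p`-independent, via
the minimal polynomial of `y` dividing `(T − y)^p`), and `exists_pIndep_adjoin`: every finite `Y ⊂ k` lies in
`k^{p^e}(b)` for a finite `p`-independent `b`.
References: [Mizutani1973HironakaGroupSchemes] Lemma 2.4 (p. 88: "c_1, …, c_m p-independent over k^p, so that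
K = k^q(c_1, …, c_m) contains the coefficients"); in-house note §3 (c), §9.
-/

open Polynomial Literature.AlgebraicGeometry.Resolution.HironakaScheme

namespace Summit.ResolutionOfSingularities.KangarooAtlas.Mizutani

universe u

section PIndep

variable {k : Type u} [Field k] {p : ℕ} [Fact p.Prime] [CharP k p]

/-- The monomial `b^W = ∏_i b_i^{W_i}` of a finite family, `W_i < q`. [folklore] -/
def fmon {s q : ℕ} (b : Fin s → k) (W : Fin s → Fin q) : k := ∏ i, b i ^ (W i : ℕ)

variable (p) in
/-- **`PIndep p j b`**: the box monomials `b^W`, `W ∈ [0, p^j − 1]^s`, are linearly independent over `k^{p^j}`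
(`j = 1`: `b` is `p`-independent). [cite: Mizutani1973HironakaGroupSchemes, Lemma 2.4 (p. 88: c_1, …, c_m p-independent over k^p)] -/
abbrev PIndep (j : ℕ) {s : ℕ} (b : Fin s → k) : Prop :=
  LinearIndependent (frobPow k p j) fun W : Fin s → Fin (p ^ j) => fmon b W

omit [Fact p.Prime] [CharP k p] in
/-- `(y, b)^{(j, W)} = y^j · b^W`. [folklore] -/
theorem fmon_cons {s q : ℕ} (y : k) (b : Fin s → k) (j : Fin q) (W : Fin s → Fin q) :
    fmon (Fin.cons y b : Fin (s + 1) → k) (Fin.cons j W : Fin (s + 1) → Fin q) = y ^ (j : ℕ) * fmon b W := by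
  unfold fmon
  rw [Fin.prod_univ_succ]
  simp only [Fin.cons_zero, Fin.cons_succ]

omit [Fact p.Prime] [CharP k p] in
/-- Box monomials lie in any intermediate field containing the family. [folklore] -/
theorem fmon_mem {K : Subfield k} {s q : ℕ} (b : Fin s → k) (F : IntermediateField K k)
    (hb : ∀ i, b i ∈ F) (W : Fin s → Fin q) : fmon b W ∈ F := by
  unfold fmon
  exact prod_mem fun i _ => pow_mem (hb i) _

omit [Fact p.Prime] [CharP k p] in
/-- The empty family is independent at every level (`b^∅ = 1 ≠ 0`). [folklore] -/
theorem linearIndependent_fmon_empty (K : Subfield k) (q : ℕ) (b : Fin 0 → k) :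
    LinearIndependent K fun W : Fin 0 → Fin q => fmon b W := by
  haveI : Subsingleton (Fin 0 → Fin q) := ⟨fun a b => funext fun i => Fin.elim0 i⟩
  refine Fintype.linearIndependent_iff.mpr fun g hg W => ?_
  have hone : ∀ W' : Fin 0 → Fin q, fmon b W' = 1 := fun W' => by unfold fmon; simp
  rw [Fintype.sum_subsingleton _ W, hone, Subfield.smul_def, smul_eq_mul, mul_one] at hg
  exact_mod_cast hg

/-- The empty family is `p`-independent. [folklore] -/
theorem pIndep_empty (j : ℕ) (b : Fin 0 → k) : PIndep p j b := linearIndependent_fmon_empty _ _ b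

/-- The digit splitting `[0, p^{j+1})^s ≃ [0, p^j)^s × [0, p)^s`, `W = W₀ + p^j W₁`. [folklore] -/
def digitSplit (p j s : ℕ) (hp : 0 < p) :
    (Fin s → Fin (p ^ (j + 1))) ≃ (Fin s → Fin (p ^ j)) × (Fin s → Fin (p ^ 1)) where
  toFun W := (fun i => ⟨(W i : ℕ) % p ^ j, Nat.mod_lt _ (Nat.pow_pos hp)⟩,
    fun i => ⟨(W i : ℕ) / p ^ j, by
      have h := Nat.div_lt_of_lt_mul (show (W i : ℕ) < p ^ j * p by rw [← pow_succ]; exact (W i).2)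
      simpa only [pow_one] using h⟩)
  invFun P := fun i => ⟨(P.1 i : ℕ) + p ^ j * (P.2 i : ℕ), by
    have h1 := (P.1 i).2
    have h2 : (P.2 i : ℕ) < p := lt_of_lt_of_eq (P.2 i).2 (pow_one p)
    calc (P.1 i : ℕ) + p ^ j * (P.2 i : ℕ) < p ^ j + p ^ j * (P.2 i : ℕ) := by omega
      _ = p ^ j * ((P.2 i : ℕ) + 1) := by ring
      _ ≤ p ^ j * p := Nat.mul_le_mul_left _ h2
      _ = p ^ (j + 1) := by rw [pow_succ]⟩
  left_inv W := by
    funext i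
    apply Fin.ext
    exact Nat.mod_add_div _ _
  right_inv P := by
    have hpj : 0 < p ^ j := Nat.pow_pos hp
    refine Prod.ext (funext fun i => Fin.ext ?_) (funext fun i => Fin.ext ?_)
    · show ((P.1 i : ℕ) + p ^ j * (P.2 i : ℕ)) % p ^ j = P.1 i
      rw [Nat.add_mul_mod_self_left, Nat.mod_eq_of_lt (P.1 i).2]
    · show ((P.1 i : ℕ) + p ^ j * (P.2 i : ℕ)) / p ^ j = P.2 i
      rw [Nat.add_mul_div_left _ _ hpj, Nat.div_eq_of_lt (P.1 i).2, zero_add]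

omit [CharP k p] in
/-- The monomial of a split exponent: `b^{W₀ + p^j W₁} = b^{W₀} · (b^{W₁})^{p^j}`. [folklore] -/
theorem fmon_digitSplit_symm {s j : ℕ} (b : Fin s → k) (P : (Fin s → Fin (p ^ j)) × (Fin s → Fin (p ^ 1))) :
    fmon b ((digitSplit p j s (Fact.out : p.Prime).pos).symm P) = fmon b P.1 * fmon b P.2 ^ p ^ j := by
  unfold fmon
  rw [← Finset.prod_pow, ← Finset.prod_mul_distrib]
  refine Finset.prod_congr rfl fun i _ => ?_
  show b i ^ ((P.1 i : ℕ) + p ^ j * (P.2 i : ℕ)) = _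
  rw [pow_add, pow_mul, ← pow_mul, ← pow_mul, mul_comm (p ^ j)]

/-- **One more level**: `PIndep j b` and `PIndep 1 b` give `PIndep (j+1) b` (write a relation over `k^{p^{j+1}}`
along the digit splitting; the `k^{p^j}`-coefficients vanish by level `j`, then take `p^j`-th roots and use
level `1`). [cite: Mizutani1973HironakaGroupSchemes, Lemma 2.4 (p. 88: the operators D_{ij}, 0 ≤ j ≤ e − 1)] -/
theorem PIndep.succ {s j : ℕ} {b : Fin s → k} (hj : PIndep p j b) (h1 : PIndep p 1 b) : PIndep p (j + 1) b := by
  classical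
  have hp : 0 < p := (Fact.out : p.Prime).pos
  have hp' : p ≠ 0 := hp.ne'
  set σ := digitSplit p j s hp with hσ
  unfold PIndep
  refine Fintype.linearIndependent_iff.mpr fun g hg => ?_
  have hg' : ∑ P : (Fin s → Fin (p ^ j)) × (Fin s → Fin (p ^ 1)),
      ((g (σ.symm P) : frobPow k p (j + 1)) : k) * (fmon b P.1 * fmon b P.2 ^ p ^ j) = 0 := by
    rw [← σ.symm.sum_comp] at hg
    rw [← hg]
    refine Finset.sum_congr rfl fun P _ => ?_
    rw [Subfield.smul_def, smul_eq_mul, fmon_digitSplit_symm]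
  rw [Fintype.sum_prod_type] at hg'
  have hγmem : ∀ W₀ : Fin s → Fin (p ^ j),
      (∑ W₁ : Fin s → Fin (p ^ 1), ((g (σ.symm (W₀, W₁)) : frobPow k p (j + 1)) : k) * fmon b W₁ ^ p ^ j) ∈
        frobPow k p j := by
    intro W₀
    refine Subfield.sum_mem _ fun W₁ _ => Subfield.mul_mem _ ?_ (pow_mem_frobPow j _)
    exact frobPow_anti (Nat.le_succ j) (g (σ.symm (W₀, W₁))).2
  set γ : (Fin s → Fin (p ^ j)) → frobPow k p j := fun W₀ => ⟨_, hγmem W₀⟩ with hγ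
  have hγ0 : ∀ W₀, γ W₀ = 0 := by
    refine Fintype.linearIndependent_iff.mp hj γ ?_
    rw [← hg']
    refine Finset.sum_congr rfl fun W₀ _ => ?_
    rw [Subfield.smul_def, smul_eq_mul, hγ, Finset.sum_mul]
    refine Finset.sum_congr rfl fun W₁ _ => ?_
    ring
  intro W
  obtain ⟨⟨W₀, W₁⟩, rfl⟩ := σ.symm.surjective W
  have hy : ∀ W₁' : Fin s → Fin (p ^ 1), ∃ y : k,
      y ^ p ^ (j + 1) = ((g (σ.symm (W₀, W₁')) : frobPow k p (j + 1)) : k) :=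
    fun W₁' => mem_frobPow_iff.mp (g (σ.symm (W₀, W₁'))).2
  choose y hy using hy
  have hrel : (∑ W₁' : Fin s → Fin (p ^ 1), y W₁' ^ p * fmon b W₁') = 0 := by
    have h0 : (∑ W₁' : Fin s → Fin (p ^ 1),
        ((g (σ.symm (W₀, W₁')) : frobPow k p (j + 1)) : k) * fmon b W₁' ^ p ^ j) = 0 := by
      have := congrArg (Subtype.val) (hγ0 W₀)
      exact this
    have heq : (∑ W₁' : Fin s → Fin (p ^ 1), y W₁' ^ p * fmon b W₁') ^ p ^ j =
        ∑ W₁' : Fin s → Fin (p ^ 1), ((g (σ.symm (W₀, W₁')) : frobPow k p (j + 1)) : k) * fmon b W₁' ^ p ^ j := by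
      rw [sum_pow_char_pow]
      refine Finset.sum_congr rfl fun W₁' _ => ?_
      rw [mul_pow, ← pow_mul, ← pow_succ', hy]
    exact (pow_eq_zero_iff (pow_ne_zero j hp')).mp (heq.trans h0)
  have hηmem : ∀ W₁' : Fin s → Fin (p ^ 1), y W₁' ^ p ∈ frobPow k p 1 := fun W₁' => by
    have := pow_mem_frobPow (p := p) 1 (y W₁')
    rwa [pow_one] at this
  set η : (Fin s → Fin (p ^ 1)) → frobPow k p 1 := fun W₁' => ⟨y W₁' ^ p, hηmem W₁'⟩ with hη
  have hη0 := Fintype.linearIndependent_iff.mp h1 η (by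
    rw [← hrel]
    refine Finset.sum_congr rfl fun W₁' _ => ?_
    rw [Subfield.smul_def, smul_eq_mul])
  have hyz : y W₁ = 0 := by
    have := congrArg Subtype.val (hη0 W₁)
    exact (pow_eq_zero_iff hp').mp this
  apply Subtype.ext
  show ((g (σ.symm (W₀, W₁)) : frobPow k p (j + 1)) : k) = 0
  rw [← hy W₁, hyz, zero_pow (pow_ne_zero _ hp')]

/-- **All levels**: a `p`-independent family has `k^{p^j}`-independent box monomials of level `p^j`, `j ≥ 1`.
[cite: Mizutani1973HironakaGroupSchemes, Lemma 2.4 (p. 88)] -/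
theorem PIndep.of_one {s : ℕ} {b : Fin s → k} (h1 : PIndep p 1 b) : ∀ j, 1 ≤ j → PIndep p j b := by
  intro j hj
  induction j, hj using Nat.le_induction with
  | base => exact h1
  | succ j _ ih => exact ih.succ h1

/-- **Exchange**: if `b` is `p`-independent and `y ∉ k^p(b)`, then `(y, b)` is `p`-independent.  A relation
`Σ_{j<p} γ_j y^j = 0` with `γ_j ∈ k^p(b)` not all zero makes the minimal polynomial of `y` over `k^p(b)` a
divisor of `(T − y)^p` of degree `d < p`, i.e. `(T − y)^d`, whose next coefficient `−d y` lies in `k^p(b)`.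
[cite: Mizutani1973HironakaGroupSchemes, Lemma 2.4 (p. 88: choosing c_1, …, c_m p-independent over k^p)] -/
theorem PIndep.cons {s : ℕ} {b : Fin s → k} (h1 : PIndep p 1 b) {y : k}
    (hy : y ∉ IntermediateField.adjoin (frobPow k p 1) (Set.range b)) :
    PIndep p 1 (Fin.cons y b : Fin (s + 1) → k) := by
  classical
  have hp : 0 < p := (Fact.out : p.Prime).pos
  set K₁ := frobPow k p 1 with hK₁
  set F₁ := IntermediateField.adjoin K₁ (Set.range b) with hF₁
  unfold PIndep
  refine Fintype.linearIndependent_iff.mpr fun g hg => ?_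
  -- reindex the relation by `(j, W')`
  have hg' : ∑ j : Fin (p ^ 1), (∑ W' : Fin s → Fin (p ^ 1), ((g (Fin.cons j W') : K₁) : k) * fmon b W') *
      y ^ (j : ℕ) = 0 := by
    rw [← (Fin.consEquiv fun _ : Fin (s + 1) => Fin (p ^ 1)).sum_comp, Fintype.sum_prod_type] at hg
    rw [← hg]
    refine Finset.sum_congr rfl fun j _ => ?_
    rw [Finset.sum_mul]
    refine Finset.sum_congr rfl fun W' _ => ?_
    simp only [Fin.consEquiv, Equiv.coe_fn_mk, Subfield.smul_def, smul_eq_mul, fmon_cons]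
    ring
  -- the coefficients `γ_j ∈ F₁`
  set γ : Fin (p ^ 1) → k := fun j => ∑ W' : Fin s → Fin (p ^ 1), ((g (Fin.cons j W') : K₁) : k) * fmon b W'
    with hγ
  have hbF : ∀ i, b i ∈ F₁ := fun i => IntermediateField.subset_adjoin _ _ ⟨i, rfl⟩
  have hγF : ∀ j, γ j ∈ F₁ := fun j =>
    sum_mem fun W' _ => mul_mem (IntermediateField.algebraMap_mem F₁ (g (Fin.cons j W'))) (fmon_mem b F₁ hbF W')
  by_cases hcase : ∀ j, γ j = 0
  · -- every `γ_j = 0`: apply the `p`-independence of `b` slice by slice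
    intro W
    have hW : W = Fin.cons (W 0) (Fin.tail W) := (Fin.cons_self_tail W).symm
    have := Fintype.linearIndependent_iff.mp h1 (fun W' => g (Fin.cons (W 0) W')) (by
      rw [← hcase (W 0), hγ]
      refine Finset.sum_congr rfl fun W' _ => ?_
      rw [Subfield.smul_def, smul_eq_mul]) (Fin.tail W)
    rw [hW]
    exact this
  · -- some `γ_j ≠ 0`: `y` is algebraic of degree `< p` over `F₁`, forcing `y ∈ F₁`
    exfalso
    push Not at hcase
    obtain ⟨j₀, hj₀⟩ := hcase
    set P : F₁[X] := ∑ j : Fin (p ^ 1), C (⟨γ j, hγF j⟩ : F₁) * X ^ (j : ℕ) with hP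
    have hPne : P ≠ 0 := by
      intro h
      have hc := congrArg (fun Q : F₁[X] => Q.coeff (j₀ : ℕ)) h
      simp only [hP, finsetSum_coeff, coeff_C_mul_X_pow, coeff_zero] at hc
      rw [Finset.sum_eq_single j₀] at hc
      · simp only [if_true] at hc
        exact hj₀ (congrArg Subtype.val hc)
      · intro j _ hj
        rw [if_neg]
        exact fun h => hj (Fin.ext h.symm)
      · intro h; exact absurd (Finset.mem_univ j₀) h
    have hPdeg : P.natDegree < p := by
      have hle : P.natDegree ≤ p - 1 :=
        natDegree_sum_le_of_forall_le _ _ fun j _ =>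
          le_trans (natDegree_C_mul_X_pow_le _ _) (by have := lt_of_lt_of_eq j.2 (pow_one p); omega)
      omega
    have hPy : aeval y P = 0 := by
      rw [hP, map_sum]
      rw [← hg']
      refine Finset.sum_congr rfl fun j _ => ?_
      rw [map_mul, map_pow, aeval_X, aeval_C]
      rfl
    -- `y` is integral: `y^p ∈ K₁ ⊆ F₁`
    have hypF : y ^ p ∈ F₁ := by
      have : y ^ p ∈ K₁ := by
        have := pow_mem_frobPow (p := p) 1 y
        rwa [pow_one] at this
      exact IntermediateField.algebraMap_mem F₁ (⟨y ^ p, this⟩ : K₁)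
    set c : F₁ := ⟨y ^ p, hypF⟩ with hc
    have hQy : aeval y (X ^ p - C c : F₁[X]) = 0 := by
      rw [map_sub, map_pow, aeval_X, aeval_C, sub_eq_zero]
      rfl
    have hint : IsIntegral F₁ y := ⟨X ^ p - C c, monic_X_pow_sub_C c hp.ne', by
      rw [← aeval_def]; exact hQy⟩
    set m := minpoly F₁ y with hm
    -- `m` divides `P` and `(X − y)^p`
    have hmP : m ∣ P := minpoly.dvd F₁ y hPy
    have hdeg_le : m.natDegree < p := lt_of_le_of_lt (natDegree_le_of_dvd hmP hPne) hPdeg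
    have hdeg_pos : 0 < m.natDegree := minpoly.natDegree_pos hint
    have hmk : m.map (algebraMap F₁ k) ∣ (X - C y) ^ p := by
      have h1 : m ∣ X ^ p - C c := minpoly.dvd F₁ y hQy
      have h2 := Polynomial.map_dvd (algebraMap F₁ k) h1
      rw [Polynomial.map_sub, Polynomial.map_pow, map_X, map_C] at h2
      have h3 : (X : k[X]) ^ p - C (algebraMap F₁ k c) = (X - C y) ^ p := by
        rw [sub_pow_char, ← C_pow]; rfl
      rwa [h3] at h2
    obtain ⟨d, hdp, hassoc⟩ := (dvd_prime_pow (prime_X_sub_C y) p).mp hmk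
    have hmeq : m.map (algebraMap F₁ k) = (X - C y) ^ d :=
      eq_of_monic_of_associated ((minpoly.monic hint).map _) ((monic_X_sub_C y).pow d) hassoc
    have hd : d = m.natDegree := by
      have := congrArg natDegree hmeq
      rw [natDegree_map, natDegree_pow, natDegree_X_sub_C, mul_one] at this
      exact this.symm
    -- the next coefficient `−d·y` of `m` lies in `F₁`
    have hnext : algebraMap F₁ k m.nextCoeff = -((d : k) * y) := by
      rw [← nextCoeff_map (algebraMap F₁ k).injective, hmeq, (monic_X_sub_C y).nextCoeff_pow, nextCoeff_X_sub_C,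
        nsmul_eq_mul, mul_neg]
    have hdne : (d : k) ≠ 0 := by
      intro h0
      rw [CharP.cast_eq_zero_iff k p] at h0
      have : p ≤ d := Nat.le_of_dvd (by omega) h0
      omega
    apply hy
    have hyeq : y = -(algebraMap F₁ k m.nextCoeff) * (d : k)⁻¹ := by
      rw [hnext, neg_neg, mul_comm (d : k) y, mul_assoc, mul_inv_cancel₀ hdne, mul_one]
    rw [hyeq]
    have hnm : algebraMap F₁ k m.nextCoeff ∈ F₁ := (m.nextCoeff).2
    exact mul_mem (neg_mem hnm) (inv_mem (natCast_mem F₁ d))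

/-- **Greedy `p`-independent extension**: every finite `Y` lies in `k^p(b')` for a `p`-independent `b'`
extending a given `p`-independent `b`. [cite: Mizutani1973HironakaGroupSchemes, Lemma 2.4 (p. 88)] -/
theorem exists_pIndep_extend_adjoin_one [DecidableEq k] (Y : Finset k) :
    ∀ {s : ℕ} (b : Fin s → k), PIndep p 1 b → ∃ (s' : ℕ) (b' : Fin s' → k), PIndep p 1 b' ∧
      Set.range b ⊆ Set.range b' ∧
      (↑Y : Set k) ⊆ (IntermediateField.adjoin (frobPow k p 1) (Set.range b') : Set k) := by
  induction Y using Finset.induction_on with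
  | empty => intro s b hb; exact ⟨s, b, hb, le_rfl, by simp⟩
  | insert y Y hyY ih =>
    intro s b hb
    obtain ⟨s', b', hb', hbb', hY⟩ := ih b hb
    by_cases hy : y ∈ IntermediateField.adjoin (frobPow k p 1) (Set.range b')
    · refine ⟨s', b', hb', hbb', ?_⟩
      rw [Finset.coe_insert]
      exact Set.insert_subset hy hY
    · refine ⟨s' + 1, Fin.cons y b', hb'.cons hy, ?_, ?_⟩
      · rw [Fin.range_cons]; exact hbb'.trans (Set.subset_insert _ _)
      · rw [Finset.coe_insert, Fin.range_cons]
        refine Set.insert_subset (IntermediateField.subset_adjoin _ _ (Set.mem_insert _ _)) ?_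
        exact hY.trans (IntermediateField.adjoin.mono _ _ _ (Set.subset_insert _ _))

/-- `z ∈ k^{p^j}(b) ⇒ z^{p^i} ∈ k^{p^{i+j}}(b)`. [folklore] -/
theorem pow_mem_adjoin {s : ℕ} (b : Fin s → k) (j i : ℕ) {z : k}
    (hz : z ∈ IntermediateField.adjoin (frobPow k p j) (Set.range b)) :
    z ^ p ^ i ∈ IntermediateField.adjoin (frobPow k p (i + j)) (Set.range b) := by
  induction hz using IntermediateField.adjoin_induction with
  | mem x hx => exact pow_mem (IntermediateField.subset_adjoin _ _ hx) _
  | algebraMap κ =>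
    have : ((κ : k)) ^ p ^ i ∈ frobPow k p (i + j) := by
      obtain ⟨w, hw⟩ := mem_frobPow_iff.mp κ.2
      refine mem_frobPow_iff.mpr ⟨w, ?_⟩
      rw [pow_add, mul_comm, pow_mul, hw]
    exact IntermediateField.algebraMap_mem _ (⟨_, this⟩ : frobPow k p (i + j))
  | add x y _ _ hx hy => rw [add_pow_char_pow]; exact add_mem hx hy
  | inv x _ hx => rw [inv_pow]; exact inv_mem hx
  | mul x y _ _ hx hy => rw [mul_pow]; exact mul_mem hx hy

/-- One level up: an element of `k^{p^e}(b₁)` lies in `k^{p^{e+1}}(b')` as soon as `b' ⊇ b₁` and finitely many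
auxiliary elements (the `p^e`-th roots of its coefficients) lie in `k^p(b')`. [folklore] -/
theorem exists_finset_lift [DecidableEq k] {s₁ : ℕ} (b₁ : Fin s₁ → k) (e : ℕ) {y : k}
    (hy : y ∈ IntermediateField.adjoin (frobPow k p e) (Set.range b₁)) :
    ∃ C : Finset k, ∀ (s' : ℕ) (b' : Fin s' → k), Set.range b₁ ⊆ Set.range b' →
      (↑C : Set k) ⊆ (IntermediateField.adjoin (frobPow k p 1) (Set.range b') : Set k) →
        y ∈ IntermediateField.adjoin (frobPow k p (e + 1)) (Set.range b') := by
  induction hy using IntermediateField.adjoin_induction with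
  | mem x hx =>
    exact ⟨∅, fun s' b' hb _ => IntermediateField.subset_adjoin _ _ (hb hx)⟩
  | algebraMap κ =>
    obtain ⟨c, hc⟩ := mem_frobPow_iff.mp κ.2
    refine ⟨{c}, fun s' b' _ hC => ?_⟩
    have hcmem : c ∈ IntermediateField.adjoin (frobPow k p 1) (Set.range b') := hC (by simp)
    have := pow_mem_adjoin b' 1 e hcmem
    rw [hc] at this
    exact this
  | add x y _ _ hx hy =>
    obtain ⟨C, hC⟩ := hx
    obtain ⟨C', hC'⟩ := hy
    refine ⟨C ∪ C', fun s' b' hb hCC => add_mem (hC s' b' hb ?_) (hC' s' b' hb ?_)⟩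
    · exact Set.Subset.trans (by rw [Finset.coe_union]; exact Set.subset_union_left) hCC
    · exact Set.Subset.trans (by rw [Finset.coe_union]; exact Set.subset_union_right) hCC
  | inv x _ hx =>
    obtain ⟨C, hC⟩ := hx
    exact ⟨C, fun s' b' hb hCC => inv_mem (hC s' b' hb hCC)⟩
  | mul x y _ _ hx hy =>
    obtain ⟨C, hC⟩ := hx
    obtain ⟨C', hC'⟩ := hy
    refine ⟨C ∪ C', fun s' b' hb hCC => mul_mem (hC s' b' hb ?_) (hC' s' b' hb ?_)⟩
    · exact Set.Subset.trans (by rw [Finset.coe_union]; exact Set.subset_union_left) hCC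
    · exact Set.Subset.trans (by rw [Finset.coe_union]; exact Set.subset_union_right) hCC

/-- **Every finite set lies in `k^{p^e}(b)` for a `p`-independent `b`** (extending a given one).
[cite: Mizutani1973HironakaGroupSchemes, Lemma 2.4 (p. 88: K = k^q(c_1, …, c_m) contains the coefficients)] -/
theorem exists_pIndep_extend_adjoin [DecidableEq k] :
    ∀ (e : ℕ) (Y : Finset k) {s : ℕ} (b : Fin s → k), PIndep p 1 b → ∃ (s' : ℕ) (b' : Fin s' → k),
      PIndep p 1 b' ∧ Set.range b ⊆ Set.range b' ∧
        (↑Y : Set k) ⊆ (IntermediateField.adjoin (frobPow k p e) (Set.range b') : Set k)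
  | 0, Y, s, b, hb => by
    refine ⟨s, b, hb, le_rfl, fun y _ => ?_⟩
    exact IntermediateField.algebraMap_mem _ (⟨y, mem_frobPow_zero y⟩ : frobPow k p 0)
  | e + 1, Y, s, b, hb => by
    obtain ⟨s₁, b₁, hb₁, hbb₁, hY⟩ := exists_pIndep_extend_adjoin e Y b hb
    have hlift : ∀ y ∈ Y, ∃ C : Finset k, ∀ (s' : ℕ) (b' : Fin s' → k), Set.range b₁ ⊆ Set.range b' →
        (↑C : Set k) ⊆ (IntermediateField.adjoin (frobPow k p 1) (Set.range b') : Set k) →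
          y ∈ IntermediateField.adjoin (frobPow k p (e + 1)) (Set.range b') :=
      fun y hy => exists_finset_lift b₁ e (hY (Finset.mem_coe.mpr hy))
    choose! C hC using hlift
    obtain ⟨s', b', hb', hbb', hCC⟩ := exists_pIndep_extend_adjoin_one (Y.biUnion C) b₁ hb₁
    refine ⟨s', b', hb', hbb₁.trans hbb', fun y hy => ?_⟩
    have hy' : y ∈ Y := Finset.mem_coe.mp hy
    refine hC y hy' s' b' hbb' (Set.Subset.trans ?_ hCC)
    rw [Finset.coe_subset]
    exact Finset.subset_biUnion_of_mem C hy'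

/-- **Finite `p`-independent envelopes**: every finite `Y ⊂ k` lies in `k^{p^e}(b)` for some finite
`p`-independent family `b` (MIZUTANI-PROOF-g59 §3 (c) without a global `p`-basis).
[cite: Mizutani1973HironakaGroupSchemes, Lemma 2.4 (p. 88)] -/
theorem exists_pIndep_adjoin [DecidableEq k] (e : ℕ) (Y : Finset k) :
    ∃ (s : ℕ) (b : Fin s → k), PIndep p 1 b ∧
      (↑Y : Set k) ⊆ (IntermediateField.adjoin (frobPow k p e) (Set.range b) : Set k) := by
  obtain ⟨s, b, hb, -, hY⟩ := exists_pIndep_extend_adjoin e Y (Fin.elim0 : Fin 0 → k) (pIndep_empty 1 _)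
  exact ⟨s, b, hb, hY⟩

end PIndep

end Summit.ResolutionOfSingularities.KangarooAtlas.Mizutani
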